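import Summits.RiemannHypothesis.RiemannHypothesis.Theses.SpectralTrace
import Literature.NumberTheory.LFunctions.WeilExplicitFormulaProofs
import Literature.NumberTheory.LFunctions.WeilExplicitProofs
import Literature.NumberTheory.LFunctions.WeilZeroSum
import Literature.NumberTheory.LFunctions.FordZetaZeroRecipSqSum
import Literature.NumberTheory.LFunctions.RiemannHypothesisUpTo101
import Literature.NumberTheory.LFunctions.LagariasXiPositivityTable
import Literature.NumberTheory.LFunctions.Brent1979Reduction
import Literature.NumberTheory.LFunctions.SimpleZeros
import Literature.NumberTheory.LFunctions.ZetaZerosProofs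
import HarnessLib

/-!
# `WindowTraceArch` — low forbidden zone, I: the located zeros of `ζ` and the zero side of `Q(g)`

First of four files of the negative lemma "every witness of the crux `WindowTraceArch`
(stmt-RiemannHypothesis-11195) avoids `(-11, 11)`" (see `…/Negative/LowZone.lean` for the
statement, the mechanism and the references). Here:

* §A the 29 bracketed simple zeros of `ζ` up to height `101` from the tree's kernel-checked
  certificate (`RiemannHypothesisUpTo101`, `Lagarias1999.zeros_of_checkZeros`, Brent's
  `simple_onLine_upTo_of_located_zeros`): `zeros_upTo_101`, and the low zeros `|Im ρ| ≤ T*`,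
  `T* = 12754/2⁸` (`low_zero`);
* §B the zero side of Weil's quadratic functional, unconditionally:
  `Re Q(g) ≤ Σ_ρ m(ρ) ‖ĝ(ρ)‖ ‖ĝ(1 - ρ̄)‖` (`re_weilQuadratic_le_tsum_zeroTerm`), split at `T*`.
-/

noncomputable section

open Complex Filter Set MeasureTheory
open scoped Real Topology ComplexConjugate ContDiff

namespace Summit.RiemannHypothesis.RiemannHypothesis.Theorems.WindowTraceArch.Negative.LowZone

open Literature.NumberTheory.LFunctions
open Literature.NumberTheory.LFunctions.ZetaZeros (riemannZetaNontrivialZeros)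

/-! ## §A The located zeros of `ζ` up to height `101` (from the tree's `RH101` certificate) -/

/-- The 29 brackets `[a/2⁸, b/2⁸]` of `RiemannHypothesisUpTo101.lean` around `γ₁, …, γ₂₉`. -/
def bracketList : List (ℕ × ℕ) :=
  [(3606, 3630), (5370, 5394), (6391, 6415), (7777, 7801), (8419, 8443),
   (9610, 9634), (10463, 10487), (11080, 11104), (12277, 12301), (12730, 12754),
   (13548, 13572), (14438, 14462), (15181, 15205), (15561, 15585), (16657, 16681),
   (17160, 17184), (17792, 17816), (18437, 18461), (19368, 19392), (19737, 19761),
   (20298, 20322), (21213, 21237), (21680, 21704), (22369, 22393), (22723, 22747),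
   (23666, 23690), (24219, 24243), (24531, 24555), (25289, 25313)]

/-- The first ten brackets (zeros below `T* = 12754/2⁸ ≈ 49.82`). -/
def bracketList10 : List (ℕ × ℕ) :=
  [(3606, 3630), (5370, 5394), (6391, 6415), (7777, 7801), (8419, 8443),
   (9610, 9634), (10463, 10487), (11080, 11104), (12277, 12301), (12730, 12754)]

/-- Every bracket contains a zero of `ζ` on the critical line (kernel-checked in
`RiemannHypothesisUpTo101.lean`, read through `Lagarias1999.zeros_of_checkZeros`). [folklore] -/
theorem exists_zero_of_mem_bracketList :
    ∀ ab ∈ bracketList, ∃ γ ∈ Icc ((ab.1 : ℝ) / 256) ((ab.2 : ℝ) / 256),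
      riemannZeta (1 / 2 + γ * I) = 0 := by
  intro ab hab
  have h1 := Lagarias1999.zeros_of_checkZeros RH101.checkZeros₁
  have h2 := Lagarias1999.zeros_of_checkZeros RH101.checkZeros₂
  have h3 := Lagarias1999.zeros_of_checkZeros RH101.checkZeros₃
  have h4 := Lagarias1999.zeros_of_checkZeros RH101.checkZeros₄
  have h5 := Lagarias1999.zeros_of_checkZeros RH101.checkZeros₅
  have h6 := Lagarias1999.zeros_of_checkZeros RH101.checkZeros₆
  have hsplit : bracketList =
      [(3606, 3630), (5370, 5394), (6391, 6415), (7777, 7801), (8419, 8443)] ++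
      [(9610, 9634), (10463, 10487), (11080, 11104), (12277, 12301), (12730, 12754)] ++
      [(13548, 13572), (14438, 14462), (15181, 15205), (15561, 15585), (16657, 16681)] ++
      [(17160, 17184), (17792, 17816), (18437, 18461), (19368, 19392), (19737, 19761)] ++
      [(20298, 20322), (21213, 21237), (21680, 21704), (22369, 22393), (22723, 22747)] ++
      [(23666, 23690), (24219, 24243), (24531, 24555), (25289, 25313)] := rfl
  rw [hsplit] at hab
  simp only [List.mem_append] at hab
  rcases hab with ((((h | h) | h) | h) | h) | h
  exacts [h1 ab h, h2 ab h, h3 ab h, h4 ab h, h5 ab h, h6 ab h]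

/-- Numerical envelope of the bracket list. -/
theorem bracketList_bounds : ∀ ab ∈ bracketList, 3606 ≤ ab.1 ∧ ab.2 ≤ 25313 := by decide

/-- The brackets with left end point `≤ 12754` are the first ten. -/
theorem mem_bracketList10_of_fst_le : ∀ ab ∈ bracketList, ab.1 ≤ 12754 → ab ∈ bracketList10 := by
  decide

/-- A chosen ordinate in each bracket (`0` off the list). -/
def pick (ab : ℕ × ℕ) : ℝ :=
  if h : ab ∈ bracketList then (exists_zero_of_mem_bracketList ab h).choose else 0

/-- The chosen ordinate lies in its bracket and is the ordinate of a critical zero. [folklore] -/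
theorem pick_spec {ab : ℕ × ℕ} (h : ab ∈ bracketList) :
    pick ab ∈ Icc ((ab.1 : ℝ) / 256) ((ab.2 : ℝ) / 256) ∧ riemannZeta (1 / 2 + pick ab * I) = 0 := by
  have := (exists_zero_of_mem_bracketList ab h).choose_spec
  simp only [pick, h, dite_true]
  exact ⟨this.1, this.2⟩

/-- The brackets are listed in increasing order and are pairwise separated. -/
theorem bracketList_pairwise : bracketList.Pairwise fun ab ab' => ab.2 < ab'.1 := by
  decide

/-- The picked ordinates are strictly increasing along the list. -/
theorem pick_pairwise : (bracketList.map pick).Pairwise (· < ·) := by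
  rw [List.pairwise_map]
  refine bracketList_pairwise.imp_of_mem ?_
  intro ab ab' hab hab' hlt
  have h1 := (pick_spec hab).1.2
  have h2 := (pick_spec hab').1.1
  have h3 : ((ab.2 : ℝ) / 256) < (ab'.1 : ℝ) / 256 := by
    have : (ab.2 : ℝ) < ab'.1 := by exact_mod_cast hlt
    linarith
  linarith

/-- The chosen ordinates are pairwise distinct. [folklore] -/
theorem pick_nodup : (bracketList.map pick).Nodup :=
  pick_pairwise.imp fun h => h.ne

/-- The finset of the 29 located ordinates. -/
def Zfin : Finset ℝ := (bracketList.map pick).toFinset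

/-- There are 29 located ordinates. [folklore] -/
theorem card_Zfin : Zfin.card = 29 := by
  rw [Zfin, List.toFinset_card_of_nodup pick_nodup, List.length_map]
  rfl

/-- Membership in the finset of located ordinates. [folklore] -/
theorem mem_Zfin_iff {t : ℝ} : t ∈ Zfin ↔ ∃ ab ∈ bracketList, pick ab = t := by
  simp [Zfin]

/-- **The zeros of `ζ` up to height `101`** are simple, on the critical line, and their ordinates
are the 29 located ones (Brent's `H(n)` criterion with `N(101) = 29`). [folklore] -/
theorem zeros_upTo_101 {ρ : ℂ} (hz : riemannZeta ρ = 0) (h0 : 0 < ρ.im) (h1 : ρ.im ≤ 101) :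
    ρ.re = 1 / 2 ∧ deriv riemannZeta ρ ≠ 0 ∧ ρ.im ∈ Zfin := by
  have hZ : ∀ γ ∈ Zfin, riemannZeta (1 / 2 + γ * I) = 0 ∧ 0 < γ ∧ γ ≤ 101 := by
    intro γ hγ
    obtain ⟨ab, hab, rfl⟩ := mem_Zfin_iff.1 hγ
    obtain ⟨⟨hlo, hhi⟩, hζ⟩ := pick_spec hab
    have hab1 : (3606 : ℝ) ≤ ab.1 ∧ (ab.2 : ℝ) ≤ 25313 := by
      obtain ⟨h1, h2⟩ := bracketList_bounds ab hab
      exact ⟨by exact_mod_cast h1, by exact_mod_cast h2⟩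
    refine ⟨hζ, ?_, ?_⟩
    · have : (0 : ℝ) < (ab.1 : ℝ) / 256 := by linarith [hab1.1]
      linarith
    · have : (ab.2 : ℝ) / 256 ≤ 101 := by linarith [hab1.2]
      linarith
  have hN : zetaZeroCount 101 ≤ Zfin.card := by
    rw [zetaZeroCount_hundredOne, card_Zfin]
  exact (simple_onLine_upTo_of_located_zeros (T := 101) Zfin hZ hN).1 ρ hz h0 h1

/-- The height below which the ten first brackets lie: `T* = 12754/2⁸`. -/
def Tstar : ℝ := 12754 / 256

/-- A located ordinate `≤ T*` comes from one of the first ten brackets. -/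
theorem mem_bracketList10_of_pick_le {ab : ℕ × ℕ} (hab : ab ∈ bracketList) (h : pick ab ≤ Tstar) :
    ab ∈ bracketList10 := by
  have hlo := (pick_spec hab).1.1
  refine mem_bracketList10_of_fst_le ab hab ?_
  have h1 : (ab.1 : ℝ) / 256 ≤ 12754 / 256 := hlo.trans h
  have h2 : (ab.1 : ℝ) ≤ 12754 := by linarith
  exact_mod_cast h2

/-- **Low zeros.** A non-trivial zero `ρ` with `|Im ρ| ≤ T*` lies on the critical line, is simple
(`m(ρ) = 1`), and `|Im ρ| = pick ab` for one of the first ten brackets `ab`. [folklore] -/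
theorem low_zero {ρ : ℂ} (hρ : ρ ∈ riemannZetaNontrivialZeros) (hT : |ρ.im| ≤ Tstar) :
    ρ.re = 1 / 2 ∧ riemannZetaZeroOrder ρ = 1 ∧ ∃ ab ∈ bracketList10, |ρ.im| = pick ab := by
  have hT101 : Tstar ≤ 101 := by norm_num [Tstar]
  have him : ρ.im ≠ 0 := ZetaZeros.riemannZetaNontrivialZeros.im_ne_zero hρ
  rcases lt_or_gt_of_ne him with hneg | hpos
  · -- `Im ρ < 0`: work with `conj ρ`
    have hc : conj ρ ∈ riemannZetaNontrivialZeros := ZetaZeros.riemannZetaNontrivialZeros.conj_mem hρ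
    have h0 : 0 < (conj ρ).im := by simp; linarith
    have h1 : (conj ρ).im ≤ 101 := by
      simp only [conj_im]
      have : |ρ.im| = -ρ.im := abs_of_neg hneg
      linarith
    obtain ⟨hre, hd, hmem⟩ := zeros_upTo_101 (ZetaZeros.riemannZetaNontrivialZeros.zeta_eq_zero hc) h0 h1
    have hord : riemannZetaZeroOrder (conj ρ) = 1 :=
      (riemannZetaZeroOrder_eq_one_iff_deriv_ne_zero hc).2 hd
    refine ⟨by simpa using hre, ?_, ?_⟩
    · rw [← riemannZetaZeroOrder_conj_holds ρ]; exact hord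
    · obtain ⟨ab, hab, hab'⟩ := mem_Zfin_iff.1 hmem
      have habs : |ρ.im| = pick ab := by rw [hab', conj_im, abs_of_neg hneg]
      exact ⟨ab, mem_bracketList10_of_pick_le hab (habs ▸ hT), habs⟩
  · have h1 : ρ.im ≤ 101 := by
      have : |ρ.im| = ρ.im := abs_of_pos hpos
      linarith
    obtain ⟨hre, hd, hmem⟩ := zeros_upTo_101 (ZetaZeros.riemannZetaNontrivialZeros.zeta_eq_zero hρ) hpos h1
    have hord : riemannZetaZeroOrder ρ = 1 :=
      (riemannZetaZeroOrder_eq_one_iff_deriv_ne_zero hρ).2 hd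
    refine ⟨hre, hord, ?_⟩
    obtain ⟨ab, hab, hab'⟩ := mem_Zfin_iff.1 hmem
    have habs : |ρ.im| = pick ab := by rw [hab', abs_of_pos hpos]
    exact ⟨ab, mem_bracketList10_of_pick_le hab (habs ▸ hT), habs⟩

/-! ## §B The zero side of the quadratic functional -/

/-- The summand `U_g(ρ) = m(ρ) ‖ĝ(ρ)‖ ‖ĝ(1 - ρ̄)‖` majorising the zero side of `Q(g)`. -/
def zeroTerm (g : ℝ → ℂ) (ρ : ℂ) : ℝ :=
  (riemannZetaZeroOrder ρ : ℝ) * ‖weilMellin g ρ‖ * ‖weilMellin g (1 - conj ρ)‖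

/-- The zero-side summand is non-negative. [folklore] -/
theorem zeroTerm_nonneg (g : ℝ → ℂ) {ρ : ℂ} (hρ : ρ ∈ riemannZetaNontrivialZeros) :
    0 ≤ zeroTerm g ρ := by
  have h1 : (0 : ℝ) ≤ riemannZetaZeroOrder ρ := by
    exact_mod_cast (riemannZetaZeroOrder_nonneg (ZetaZeros.riemannZetaNontrivialZeros.ne_one hρ))
  unfold zeroTerm
  positivity

/-- The zero side of `Q(g) = W(g ⋆ g̃)`: the norm of the `ρ`-th term of the explicit formula for
`g ⋆ g̃` IS `U_g(ρ)` (`(g ⋆ g̃)^(s) = ĝ(s) conj ĝ(1 - s̄)`). [folklore] -/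
theorem norm_term_weilConv_weilReflect {g : ℝ → ℂ} (hg : IsWeilTest g) {ρ : ℂ}
    (hρ : ρ ∈ riemannZetaNontrivialZeros) :
    ‖(riemannZetaZeroOrder ρ : ℂ) * weilMellin (weilConv g (weilReflect g)) ρ‖ = zeroTerm g ρ := by
  have h1 : (0 : ℝ) ≤ riemannZetaZeroOrder ρ := by
    exact_mod_cast (riemannZetaZeroOrder_nonneg (ZetaZeros.riemannZetaNontrivialZeros.ne_one hρ))
  rw [weilMellin_weilQuadratic hg ρ, norm_mul, norm_mul, Complex.norm_intCast, abs_of_nonneg h1,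
    Complex.norm_conj, zeroTerm, mul_assoc]

/-- Summability of the zero side of `Q(g)`. [folklore] -/
theorem summable_zeroTerm {g : ℝ → ℂ} (hg : IsWeilTest g) :
    Summable fun ρ : riemannZetaNontrivialZeros => zeroTerm g ρ := by
  have hk : IsWeilTest (weilConv g (weilReflect g)) := hg.weilConv hg.weilReflect
  refine (summable_norm_zeroSide hk).congr fun ρ => ?_
  exact norm_term_weilConv_weilReflect hg ρ.2

/-- **The quadratic functional is bounded by the zero side**: unconditionally
`Re Q(g) ≤ Σ_ρ m(ρ) ‖ĝ(ρ)‖ ‖ĝ(1 - ρ̄)‖` (explicit formula for `g ⋆ g̃`, absolute convergence).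
[folklore] -/
theorem re_weilQuadratic_le_tsum_zeroTerm {g : ℝ → ℂ} (hg : IsWeilTest g) :
    (weilQuadratic g).re ≤ ∑' ρ : riemannZetaNontrivialZeros, zeroTerm g ρ := by
  have hk : IsWeilTest (weilConv g (weilReflect g)) := hg.weilConv hg.weilReflect
  have hS := summable_norm_zeroSide hk
  have hEF : ∑' ρ : riemannZetaNontrivialZeros,
      (riemannZetaZeroOrder (ρ : ℂ) : ℂ) * weilMellin (weilConv g (weilReflect g)) ρ =
        weilQuadratic g :=
    tendsto_nhds_unique (hasWeilZeroSide_tsum hS) (explicit_formula_holds hk)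
  calc (weilQuadratic g).re ≤ ‖weilQuadratic g‖ := Complex.re_le_norm _
    _ = ‖∑' ρ : riemannZetaNontrivialZeros,
          (riemannZetaZeroOrder (ρ : ℂ) : ℂ) * weilMellin (weilConv g (weilReflect g)) ρ‖ := by
        rw [hEF]
    _ ≤ ∑' ρ : riemannZetaNontrivialZeros,
          ‖(riemannZetaZeroOrder (ρ : ℂ) : ℂ) * weilMellin (weilConv g (weilReflect g)) ρ‖ :=
        norm_tsum_le_tsum_norm hS
    _ = ∑' ρ : riemannZetaNontrivialZeros, zeroTerm g ρ :=
        tsum_congr fun ρ => norm_term_weilConv_weilReflect hg ρ.2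

/-- The set of low zeros `|Im ρ| ≤ T*` is finite. -/
theorem finite_lowZeros : {ρ : riemannZetaNontrivialZeros | |(ρ : ℂ).im| ≤ Tstar}.Finite := by
  have h := weilZeroIndex_finite Tstar
  rw [weilZeroIndex_eq_inter] at h
  have : {ρ : riemannZetaNontrivialZeros | |(ρ : ℂ).im| ≤ Tstar} =
      ((↑) : riemannZetaNontrivialZeros → ℂ) ⁻¹' (riemannZetaNontrivialZeros ∩ {ρ | |ρ.im| ≤ Tstar}) := by
    ext ρ
    simp
  rw [this]
  exact h.preimage Subtype.coe_injective.injOn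

/-- The finset of low zeros. -/
def lowZeros : Finset riemannZetaNontrivialZeros := finite_lowZeros.toFinset

/-- Membership in the finset of low zeros. [folklore] -/
theorem mem_lowZeros {ρ : riemannZetaNontrivialZeros} : ρ ∈ lowZeros ↔ |(ρ : ℂ).im| ≤ Tstar := by
  simp [lowZeros]

/-- Splitting the zero side at height `T*`: finite low part plus the high tail. [folklore] -/
theorem tsum_zeroTerm_eq_add {g : ℝ → ℂ} (hg : IsWeilTest g) :
    ∑' ρ : riemannZetaNontrivialZeros, zeroTerm g ρ =
      ∑ ρ ∈ lowZeros, zeroTerm g ρ +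
        ∑' ρ : {ρ : riemannZetaNontrivialZeros // ρ ∉ lowZeros}, zeroTerm g ρ :=
  ((summable_zeroTerm hg).sum_add_tsum_subtype_compl lowZeros).symm

end Summit.RiemannHypothesis.RiemannHypothesis.Theorems.WindowTraceArch.Negative.LowZone

end
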